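import Literature.MathematicalPhysics.QuantumLattice.LiebSpinReflection
import Mathlib.Analysis.SpecialFunctions.ContinuousFunctionalCalculus.Abs
import Mathlib.Analysis.CStarAlgebra.Matrix
import Mathlib.Analysis.Matrix.Order
import Mathlib.Analysis.Matrix.HermitianFunctionalCalculus
import HarnessLib

/-!
# Route `LiebTwin`, crux `TwinOnsiteCondensation` (stmt-HubbardSuperconductivity-15258), line `majorant`:
# matrix-analysis core of the majorants M1/M2 (helper, `--supports`)

Two facts of finite-dimensional matrix analysis used by both majorant stubs of the line
(`stub_pairCoherenceMajorant`, `stub_spinFlipMajorant`):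

* `frobenius_block_cauchy_schwarz` — for rectangular `P : a × J`, `Q : J × b` and a contraction
  `K : J × J` (`‖Kv‖² ≤ ‖v‖²` for all `v`): `‖P K Q‖_F⁴ ≤ ‖P Pᴴ‖_F² · ‖Qᴴ Q‖_F²`
  (`‖P K Q‖²_F = Tr((PᴴP)(K Q Qᴴ Kᴴ)) ≤ ‖PᴴP‖_F ‖K QQᴴ Kᴴ‖_F ≤ ‖PPᴴ‖_F ‖QQᴴ‖_F`);
* `exists_mul_eq_conjTranspose_mul_eq_cfcAbs` — a hand-made polar/SVD split of a square matrix: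
  `W = S T` with `Tᴴ T = |W| = CFC.abs W = (WᴴW)^{1/2}` and `Tr((SSᴴ)²) = Tr(WᴴW)`
  (`T = |W|^{1/2}`, `S = W (|W|^{1/2})⁺` from the eigen-decomposition `WᴴW = U diag(λ) Uᴴ`;
  `CFC.sqrt` of a positive semidefinite matrix is `U diag(√λ) Uᴴ` by Mathlib's Hermitian functional
  calculus `Matrix.IsHermitian.cfc_eq`).

Sources: R. A. Horn, C. R. Johnson, *Matrix Analysis* (2nd ed., 2012) §5.6 (Frobenius norm,
submultiplicativity, Cauchy–Schwarz for the trace form) and §7.3 (polar and singular value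
decompositions); E. H. Lieb, PRL **62** (1989) 1201, proof of Theorem 1 (`|W|` from the
eigen-decomposition). Everything is bookkeeping; no definition and no named fact is introduced.
-/

-- the mandated namespace `Summit.<Summit>.<Problem>.Theorems` repeats `HubbardSuperconductivity`
-- (single-problem summit, D-0017), which the `dupNamespace` linter flags on every declaration
set_option linter.dupNamespace false

noncomputable section

namespace Summit.HubbardSuperconductivity.HubbardSuperconductivity.Theorems.LiebTwinMajorant

open Matrix Finset Literature.MathematicalPhysics.QuantumLattice
open scoped ComplexOrder MatrixOrder Matrix.Norms.L2Operator

/-! ### Frobenius forms `Tr(Xᴴ X) = Σ |X_{ab}|²` of rectangular matrices -/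

section Frobenius

variable {m n k : Type*} [Fintype m] [Fintype n] [Fintype k]

/-- `Tr(Xᴴ X) = Σ_{a,b} |X_{ab}|²` for a rectangular complex matrix (cast from `ℝ`).
Horn–Johnson, Matrix Analysis (2012) §5.6. [folklore] -/
theorem trace_conjTranspose_mul_self_eq_sum (X : Matrix m n ℂ) :
    (Xᴴ * X).trace = ((∑ a, ∑ b, ‖X a b‖ ^ 2 : ℝ) : ℂ) := by
  rw [Matrix.trace]
  simp only [Matrix.diag_apply, Matrix.mul_apply, conjTranspose_apply]
  rw [Finset.sum_comm]
  push_cast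
  refine Finset.sum_congr rfl fun a _ => Finset.sum_congr rfl fun b _ => ?_
  rw [Complex.star_def, Complex.conj_mul']

/-- `Re Tr(Xᴴ X) = Σ_{a,b} |X_{ab}|²`. Horn–Johnson, Matrix Analysis (2012) §5.6. [folklore] -/
theorem re_trace_conjTranspose_mul_self (X : Matrix m n ℂ) :
    ((Xᴴ * X).trace).re = ∑ a, ∑ b, ‖X a b‖ ^ 2 := by
  rw [trace_conjTranspose_mul_self_eq_sum, Complex.ofReal_re]

/-- `0 ≤ Re Tr(Xᴴ X)`. [folklore] -/
theorem re_trace_conjTranspose_mul_self_nonneg (X : Matrix m n ℂ) : 0 ≤ ((Xᴴ * X).trace).re := by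
  rw [re_trace_conjTranspose_mul_self]
  positivity

/-- `Tr(Xᴴᴴ Xᴴ) = Tr(Xᴴ X)`: a matrix and its adjoint have the same Frobenius norm. [folklore] -/
theorem trace_self_mul_conjTranspose (X : Matrix m n ℂ) :
    (Xᴴᴴ * Xᴴ).trace = (Xᴴ * X).trace := by
  rw [conjTranspose_conjTranspose, Matrix.trace_mul_comm]

/-- `‖Pᴴ P‖_F = ‖P Pᴴ‖_F`: `Tr((PᴴP)ᴴ(PᴴP)) = Tr((PPᴴ)ᴴ(PPᴴ))` by cyclicity of the trace.
Horn–Johnson, Matrix Analysis (2012) §7.3 (the nonzero singular values of `P` and `Pᴴ` agree). [folklore] -/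
theorem trace_gram_sq_eq (P : Matrix m n ℂ) :
    ((Pᴴ * P)ᴴ * (Pᴴ * P)).trace = ((P * Pᴴ)ᴴ * (P * Pᴴ)).trace := by
  rw [conjTranspose_mul, conjTranspose_conjTranspose, conjTranspose_mul, conjTranspose_conjTranspose,
    show Pᴴ * P * (Pᴴ * P) = Pᴴ * (P * Pᴴ * P) by simp only [Matrix.mul_assoc], Matrix.trace_mul_comm,
    Matrix.mul_assoc]

/-- A contraction does not increase the Frobenius norm from the left: `‖K M‖_F ≤ ‖M‖_F`
(columnwise `‖K m_c‖ ≤ ‖m_c‖`). Horn–Johnson, Matrix Analysis (2012) §5.6. [folklore] -/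
theorem re_trace_contraction_mul_le {K : Matrix n n ℂ}
    (hK : ∀ v : n → ℂ, (star (K *ᵥ v) ⬝ᵥ (K *ᵥ v)).re ≤ (star v ⬝ᵥ v).re) (M : Matrix n k ℂ) :
    (((K * M)ᴴ * (K * M)).trace).re ≤ ((Mᴴ * M).trace).re := by
  rw [re_trace_conjTranspose_mul_self, re_trace_conjTranspose_mul_self, Finset.sum_comm,
    Finset.sum_comm (f := fun a b => ‖M a b‖ ^ 2)]
  refine Finset.sum_le_sum fun c _ => ?_
  -- `Re ⟨w, w⟩ = Σ |w_i|²`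
  have key : ∀ w : n → ℂ, (star w ⬝ᵥ w).re = ∑ i, ‖w i‖ ^ 2 := fun w => by
    rw [dotProduct, Complex.re_sum]
    refine Finset.sum_congr rfl fun i _ => ?_
    rw [Pi.star_apply, Complex.star_def, Complex.conj_mul']
    norm_cast
  have h := hK fun j => M j c
  rw [key, key] at h
  exact h

/-- A contraction does not increase the Frobenius norm from the right by its adjoint:
`‖M Kᴴ‖_F ≤ ‖M‖_F`. Horn–Johnson, Matrix Analysis (2012) §5.6. [folklore] -/
theorem re_trace_mul_contraction_conjTranspose_le {K : Matrix n n ℂ}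
    (hK : ∀ v : n → ℂ, (star (K *ᵥ v) ⬝ᵥ (K *ᵥ v)).re ≤ (star v ⬝ᵥ v).re) (M : Matrix k n ℂ) :
    (((M * Kᴴ)ᴴ * (M * Kᴴ)).trace).re ≤ ((Mᴴ * M).trace).re := by
  have h1 : (M * Kᴴ)ᴴ * (M * Kᴴ) = (K * Mᴴ)ᴴᴴ * (K * Mᴴ)ᴴ := by
    simp only [conjTranspose_mul, conjTranspose_conjTranspose, Matrix.mul_assoc]
  rw [h1, trace_self_mul_conjTranspose (K * Mᴴ), ← trace_self_mul_conjTranspose M]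
  exact re_trace_contraction_mul_le hK Mᴴ

/-- **Cauchy–Schwarz for the trace form**: `|Tr(S T)|² ≤ ‖S‖_F² ‖T‖_F²`.
Horn–Johnson, Matrix Analysis (2012) §5.6. [folklore] -/
theorem norm_trace_mul_sq_le (S : Matrix m n ℂ) (T : Matrix n m ℂ) :
    ‖(S * T).trace‖ ^ 2 ≤ ((Sᴴ * S).trace).re * ((Tᴴ * T).trace).re := by
  rw [re_trace_conjTranspose_mul_self, re_trace_conjTranspose_mul_self]
  -- `|Tr(ST)| ≤ Σ_{a,b} |S_{ab}| |T_{ba}|`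
  have h1 : ‖(S * T).trace‖ ≤ ∑ p : m × n, ‖S p.1 p.2‖ * ‖T p.2 p.1‖ := by
    rw [Matrix.trace]
    simp only [Matrix.diag_apply, Matrix.mul_apply]
    rw [Fintype.sum_prod_type]
    refine (norm_sum_le _ _).trans (Finset.sum_le_sum fun a _ => ?_)
    refine (norm_sum_le _ _).trans (Finset.sum_le_sum fun b _ => ?_)
    rw [norm_mul]
  have h2 : (∑ p : m × n, ‖S p.1 p.2‖ * ‖T p.2 p.1‖) ^ 2 ≤
      (∑ p : m × n, ‖S p.1 p.2‖ ^ 2) * ∑ p : m × n, ‖T p.2 p.1‖ ^ 2 :=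
    Finset.sum_mul_sq_le_sq_mul_sq _ _ _
  have hS : ∑ p : m × n, ‖S p.1 p.2‖ ^ 2 = ∑ a, ∑ b, ‖S a b‖ ^ 2 := Fintype.sum_prod_type _
  have hT : ∑ p : m × n, ‖T p.2 p.1‖ ^ 2 = ∑ a, ∑ b, ‖T a b‖ ^ 2 := by
    rw [Fintype.sum_prod_type, Finset.sum_comm]
  rw [hS, hT] at h2
  exact (pow_le_pow_left₀ (norm_nonneg _) h1 2).trans h2

/-- **Frobenius block Cauchy–Schwarz.** For rectangular `P`, `Q` and a contraction `K`
(`‖Kv‖² ≤ ‖v‖²`): `(Σ|(PKQ)_{ij}|²)² ≤ (Σ|(PPᴴ)_{ii'}|²)(Σ|(QᴴQ)_{jj'}|²)`, i.e.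
`‖PKQ‖_F⁴ ≤ ‖PPᴴ‖²_F ‖QᴴQ‖²_F` (`‖PKQ‖²_F = Tr((PᴴP)(KQQᴴKᴴ)) ≤ ‖PᴴP‖_F‖KQQᴴKᴴ‖_F`,
`‖PᴴP‖_F = ‖PPᴴ‖_F`, `‖K(QQᴴ)Kᴴ‖_F ≤ ‖QQᴴ‖_F = ‖QᴴQ‖_F`).
Horn–Johnson, Matrix Analysis (2012) §5.6 and §7.3. [folklore] -/
theorem frobenius_block_cauchy_schwarz :
    ∀ {a b J : Type*} [Fintype a] [Fintype b] [Fintype J] (P : Matrix a J ℂ) (K : Matrix J J ℂ)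
      (Q : Matrix J b ℂ), (∀ v : J → ℂ, (star (K *ᵥ v) ⬝ᵥ (K *ᵥ v)).re ≤ (star v ⬝ᵥ v).re) →
      (∑ i, ∑ j, ‖(P * K * Q) i j‖ ^ 2) ^ 2 ≤
        (∑ i, ∑ i', ‖(P * Pᴴ) i i'‖ ^ 2) * (∑ j, ∑ j', ‖(Qᴴ * Q) j j'‖ ^ 2) := by
  intro a b J _ _ _ P K Q hK
  rw [← re_trace_conjTranspose_mul_self, ← re_trace_conjTranspose_mul_self,
    ← re_trace_conjTranspose_mul_self]
  -- `‖PKQ‖²_F = Tr((PᴴP)(KQQᴴKᴴ))`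
  have hcyc : ((P * K * Q)ᴴ * (P * K * Q)).trace = ((Pᴴ * P) * (K * (Q * Qᴴ) * Kᴴ)).trace := by
    rw [conjTranspose_mul, conjTranspose_mul,
      show Qᴴ * (Kᴴ * Pᴴ) * (P * K * Q) = Qᴴ * Kᴴ * (Pᴴ * P * K * Q) by simp only [Matrix.mul_assoc],
      Matrix.trace_mul_comm]
    simp only [Matrix.mul_assoc]
  have hCS := norm_trace_mul_sq_le (Pᴴ * P) (K * (Q * Qᴴ) * Kᴴ)
  have hre : (((P * K * Q)ᴴ * (P * K * Q)).trace).re ^ 2 ≤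
      ‖((Pᴴ * P) * (K * (Q * Qᴴ) * Kᴴ)).trace‖ ^ 2 := by
    rw [hcyc, ← sq_abs]
    exact pow_le_pow_left₀ (abs_nonneg _) (Complex.abs_re_le_norm _) 2
  -- `‖K (QQᴴ) Kᴴ‖_F ≤ ‖QQᴴ‖_F = ‖QᴴQ‖_F`
  have hK2 : (((K * (Q * Qᴴ) * Kᴴ)ᴴ * (K * (Q * Qᴴ) * Kᴴ)).trace).re ≤ (((Qᴴ * Q)ᴴ * (Qᴴ * Q)).trace).re := by
    refine (re_trace_mul_contraction_conjTranspose_le hK (K * (Q * Qᴴ))).trans ?_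
    refine (re_trace_contraction_mul_le hK (Q * Qᴴ)).trans_eq ?_
    have := trace_gram_sq_eq Qᴴ
    rw [conjTranspose_conjTranspose] at this
    rw [this]
  rw [trace_gram_sq_eq P] at hCS
  refine hre.trans (hCS.trans ?_)
  exact mul_le_mul_of_nonneg_left hK2 (re_trace_conjTranspose_mul_self_nonneg _)

end Frobenius

/-! ### The polar split `W = S T`, `TᴴT = |W|`, `Tr((SSᴴ)²) = Tr(WᴴW)` -/

section Polar

variable {ι : Type*} [Fintype ι] [DecidableEq ι]

/-- **`CFC.sqrt` of a positive semidefinite matrix in its eigenbasis**: `H^{1/2} = U diag(√λ) Uᴴ` for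
`H = U diag(λ) Uᴴ` (`U` the eigenvector unitary, `λ ≥ 0` the eigenvalues) — Mathlib's Hermitian functional
calculus `Matrix.IsHermitian.cfc_eq`. Horn–Johnson, Matrix Analysis (2012) Thm 7.2.6. [folklore] -/
theorem cfcSqrt_eq_unitConj {H : Matrix ι ι ℂ} (hH : H.PosSemidef) :
    CFC.sqrt H = unitConj (hH.1.eigenvectorUnitary : Matrix ι ι ℂ) (fun i => Real.sqrt (hH.1.eigenvalues i)) := by
  rw [CFC.sqrt_eq_cfc, cfc_nnreal_eq_real _ H hH.nonneg, hH.1.cfc_eq, Matrix.IsHermitian.cfc,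
    Unitary.conjStarAlgAut_apply, star_eq_conjTranspose, unitConj]
  have hfun : (RCLike.ofReal ∘ (fun x : ℝ => ((NNReal.sqrt x.toNNReal : NNReal) : ℝ)) ∘ hH.1.eigenvalues) =
      fun i => ((Real.sqrt (hH.1.eigenvalues i) : ℝ) : ℂ) := by
    funext i
    simp only [Function.comp_apply, Real.coe_sqrt, Real.coe_toNNReal', max_eq_left (hH.eigenvalues_nonneg i)]
    rfl
  rw [hfun]

/-- **`|W| = U diag(√λ) Uᴴ`** for every square matrix `W`, where `WᴴW = U diag(λ) Uᴴ` is the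
eigen-decomposition of the positive semidefinite `WᴴW` (`|W| = CFC.abs W = CFC.sqrt (WᴴW)`).
Lieb, PRL 62 (1989) 1201, proof of Theorem 1; Horn–Johnson (2012) §7.3. [folklore] -/
theorem cfcAbs_eq_unitConj_sqrt (W : Matrix ι ι ℂ) :
    CFC.abs W = unitConj ((Matrix.posSemidef_conjTranspose_mul_self W).1.eigenvectorUnitary : Matrix ι ι ℂ)
      (fun i => Real.sqrt ((Matrix.posSemidef_conjTranspose_mul_self W).1.eigenvalues i)) := by
  rw [← cfcSqrt_eq_unitConj (Matrix.posSemidef_conjTranspose_mul_self W)]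
  rfl

/-- `Uᴴ H U = diag(λ)` for a Hermitian `H` with eigenvector unitary `U` and eigenvalues `λ`.
Horn–Johnson, Matrix Analysis (2012) Thm 2.5.6. [folklore] -/
theorem conjTranspose_eigenvectorUnitary_mul_mul {H : Matrix ι ι ℂ} (hH : H.IsHermitian) :
    (hH.eigenvectorUnitary : Matrix ι ι ℂ)ᴴ * H * (hH.eigenvectorUnitary : Matrix ι ι ℂ) =
      diagonal (fun i => ((hH.eigenvalues i : ℝ) : ℂ)) := by
  have := hH.conjStarAlgAut_star_eigenvectorUnitary
  rw [Unitary.conjStarAlgAut_apply, Unitary.coe_star, star_star, star_eq_conjTranspose] at this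
  exact this

/-- The columns of `W U` belonging to zero eigenvalues of `WᴴW = U diag(λ) Uᴴ` vanish:
`λ_i = 0 ⟹ (W U)_{k i} = 0` (`‖(WU)_{·i}‖² = (Uᴴ Wᴴ W U)_{ii} = λ_i`). Horn–Johnson (2012) §7.3
(`ker |W| = ker W`). [folklore] -/
theorem mul_eigenvectorUnitary_apply_eq_zero (W : Matrix ι ι ℂ) {i : ι}
    (hi : (Matrix.posSemidef_conjTranspose_mul_self W).1.eigenvalues i = 0) (k : ι) :
    (W * ((Matrix.posSemidef_conjTranspose_mul_self W).1.eigenvectorUnitary : Matrix ι ι ℂ)) k i = 0 := by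
  set hH := (Matrix.posSemidef_conjTranspose_mul_self W).1 with hHdef
  set U : Matrix ι ι ℂ := (hH.eigenvectorUnitary : Matrix ι ι ℂ) with hU
  have hdiag := conjTranspose_eigenvectorUnitary_mul_mul hH
  have hWU : Uᴴ * (Wᴴ * W) * U = (W * U)ᴴ * (W * U) := by
    rw [conjTranspose_mul]; simp only [Matrix.mul_assoc]
  have hii := congrFun (congrFun hdiag i) i
  rw [diagonal_apply_eq, hi, Complex.ofReal_zero, hWU, Matrix.mul_apply] at hii
  simp only [conjTranspose_apply, Complex.star_def, Complex.conj_mul'] at hii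
  -- `Σ_k |(WU)_{ki}|² = 0`
  have hsum : ∑ k, ‖(W * U) k i‖ ^ 2 = 0 := by exact_mod_cast hii
  have hk := (Finset.sum_eq_zero_iff_of_nonneg (fun k _ => sq_nonneg _)).1 hsum k (Finset.mem_univ k)
  exact norm_eq_zero.1 (pow_eq_zero_iff (n := 2) (by norm_num) |>.1 hk)

/-- **Polar split of a square matrix.** Every `W` factors as `W = S T` with `Tᴴ T = |W|` (`|W| = CFC.abs W`)
and `Tr((SSᴴ)²) = Tr(WᴴW)`: with `WᴴW = U diag(λ) Uᴴ`, take `T = U diag(λ^{1/4}) Uᴴ = |W|^{1/2}` and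
`S = W U diag(τ) Uᴴ`, `τ = λ^{-1/4}` on `λ > 0` and `0` on `λ = 0` (`S = W(|W|^{1/2})⁺`), using that the
columns of `WU` with `λ = 0` vanish. Horn–Johnson, Matrix Analysis (2012) Thm 7.3.1 (polar decomposition);
Lieb, PRL 62 (1989) 1201, proof of Theorem 1. [folklore] -/
theorem exists_mul_eq_conjTranspose_mul_eq_cfcAbs :
    ∀ {ι : Type*} [Fintype ι] [DecidableEq ι] (W : Matrix ι ι ℂ),
      ∃ S T : Matrix ι ι ℂ, S * T = W ∧ Tᴴ * T = CFC.abs W ∧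
        ((S * Sᴴ) * (S * Sᴴ)).trace = (Wᴴ * W).trace := by
  intro ι _ _ W
  set hH := (Matrix.posSemidef_conjTranspose_mul_self W) with hHdef
  set U : Matrix ι ι ℂ := (hH.1.eigenvectorUnitary : Matrix ι ι ℂ) with hU
  set ev : ι → ℝ := hH.1.eigenvalues with hev
  have hUU : Uᴴ * U = 1 := by
    have h := Unitary.coe_star_mul_self hH.1.eigenvectorUnitary
    rw [star_eq_conjTranspose] at h
    exact h
  have hUU' : U * Uᴴ = 1 := by
    have h := Unitary.coe_mul_star_self hH.1.eigenvectorUnitary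
    rw [Unitary.coe_star, star_eq_conjTranspose] at h
    exact h
  have hev0 : ∀ i, 0 ≤ ev i := fun i => hH.eigenvalues_nonneg i
  -- the quarter root `r = λ^{1/4}`, its pseudo-inverse `τ`, and the support indicator `χ`
  set r : ι → ℝ := fun i => Real.sqrt (Real.sqrt (ev i)) with hr
  set τ : ι → ℝ := fun i => if ev i = 0 then 0 else (r i)⁻¹ with hτ
  set χ : ι → ℝ := fun i => if ev i = 0 then 0 else 1 with hχ
  have hrpos : ∀ i, ev i ≠ 0 → 0 < r i := fun i hi =>
    Real.sqrt_pos.2 (Real.sqrt_pos.2 (lt_of_le_of_ne (hev0 i) (Ne.symm hi)))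
  have hτr : τ * r = χ := by
    funext i
    simp only [Pi.mul_apply, hτ, hχ]
    split_ifs with hi
    · rw [zero_mul]
    · rw [inv_mul_cancel₀ (hrpos i hi).ne']
  have hrr : r * r = fun i => Real.sqrt (ev i) := by
    funext i; exact Real.mul_self_sqrt (Real.sqrt_nonneg _)
  have hτ4 : τ * τ * ev * (τ * τ) = χ := by
    funext i
    simp only [Pi.mul_apply, hτ, hχ]
    split_ifs with hi
    · simp
    · have hri : r i ≠ 0 := (hrpos i hi).ne'
      have hr2 : r i * r i = Real.sqrt (ev i) := Real.mul_self_sqrt (Real.sqrt_nonneg _)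
      have hr4 : Real.sqrt (ev i) * Real.sqrt (ev i) = ev i := Real.mul_self_sqrt (hev0 i)
      have hev4 : ev i = r i * r i * (r i * r i) := by rw [hr2, hr4]
      rw [hev4]
      field_simp
  -- the key support identity `W · U diag(χ) Uᴴ = W`
  have hWχ : W * unitConj U χ = W := by
    have hcol : W * U * diagonal (fun i => ((χ i : ℝ) : ℂ)) = W * U := by
      ext k i
      rw [mul_diagonal]
      simp only [hχ]
      split_ifs with hi
      · rw [Complex.ofReal_zero, mul_zero]
        exact (mul_eigenvectorUnitary_apply_eq_zero W hi k).symm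
      · rw [Complex.ofReal_one, mul_one]
    rw [unitConj, ← Matrix.mul_assoc, ← Matrix.mul_assoc, hcol, Matrix.mul_assoc, hUU', Matrix.mul_one]
  have habs : CFC.abs W = unitConj U (fun i => Real.sqrt (ev i)) := cfcAbs_eq_unitConj_sqrt W
  have hH' : Wᴴ * W = unitConj U ev := by
    have h := conjTranspose_eigenvectorUnitary_mul_mul hH.1
    rw [← hU] at h
    rw [unitConj, ← h]
    rw [show U * (Uᴴ * (Wᴴ * W) * U) * Uᴴ = (U * Uᴴ) * (Wᴴ * W) * (U * Uᴴ) by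
      simp only [Matrix.mul_assoc], hUU', Matrix.one_mul, Matrix.mul_one]
  refine ⟨W * unitConj U τ, unitConj U r, ?_, ?_, ?_⟩
  · rw [Matrix.mul_assoc, unitConj_mul_unitConj hUU, hτr, hWχ]
  · rw [unitConj_conjTranspose, unitConj_mul_unitConj hUU, hrr, habs]
  · have hSS : W * unitConj U τ * (W * unitConj U τ)ᴴ = W * unitConj U (τ * τ) * Wᴴ := by
      rw [conjTranspose_mul, unitConj_conjTranspose, Matrix.mul_assoc, ← Matrix.mul_assoc (unitConj U τ),
        unitConj_mul_unitConj hUU, ← Matrix.mul_assoc]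
    rw [hSS, show W * unitConj U (τ * τ) * Wᴴ * (W * unitConj U (τ * τ) * Wᴴ) =
        W * (unitConj U (τ * τ) * (Wᴴ * W) * unitConj U (τ * τ)) * Wᴴ by simp only [Matrix.mul_assoc],
      hH', unitConj_mul_unitConj hUU, unitConj_mul_unitConj hUU, hτ4, hWχ, Matrix.trace_mul_comm, hH']

end Polar

end Summit.HubbardSuperconductivity.HubbardSuperconductivity.Theorems.LiebTwinMajorant

end
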